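import Mathlib.Algebra.Homology.HomologySequenceLemmas
import Literature.AlgebraicTopology.SingularHomology.CohomologyBockstein
import Literature.AlgebraicTopology.SingularHomology.CupProduct
import HarnessLib

/-!
# Cohomology operations

Topic `Literature/AlgebraicTopology/SingularHomology` (trunk G04). A **cohomology operation** of
type `(m, M; n, N)` is a transformation `Θ = Θ_X : Hᵐ(X; M) → Hⁿ(X; N)` defined for all spaces `X`
and natural in continuous maps: `Θ_X (f^* α) = f^* (Θ_Y α)` for `f : X → Y` (A. Hatcher,
*Algebraic Topology* (2002), §4.L, p. 488). Operations need not be homomorphisms (Hatcher, loc.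
cit.: `α ↦ αᵖ` with `ℤ`-coefficients is not); the **additive** ones (Steenrod squares and reduced
powers, Bockstein homomorphisms, change of coefficients) form the structure
`AddCohomologyOperation`. Everything in this file is a real definition or a proved statement about
the tree's singular cohomology `singularCohomology R M X n` (`…SingularCochains`):

* `CohomologyOperation R M N m n`, `AddCohomologyOperation R M N m n` (structures: the family
  `app X` and its naturality, resp. additivity), with `id`, `comp`, `ext`, and for additive
  operations the bundled `addMonoidHom`, `map_zero/neg/sub/zsmul`, the kernel `ker X` and its
  functoriality `map_mem_ker`;
* the three examples of Hatcher, §4.L p. 488, PROVED to be operations: change of coefficients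
  `AddCohomologyOperation.mapCoeff` (naturality = `singularCohomology.map_mapCoeff`), the Bockstein
  of a short exact coefficient sequence `AddCohomologyOperation.bockstein` — in particular the
  reduction `reduceMod m` and the integral Bockstein `integralBockstein m` of `0 → ℤ → ℤ → ℤ/m → 0`
  (naturality in the space, `cohomologyBockstein_natural`, proved here from Mathlib's
  `HomologicalComplex.HomologySequence.δ_naturality`), and the cup square `cupSquare`
  (`α ↦ α ⌣ α`, not additive; naturality = `cupProduct_map`).

Deliberately NOT here: Steenrod squares / reduced powers themselves (Hatcher §4.L, properties
(1)–(7); no construction in Mathlib or the tree yet) and the classification of operations by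
`Hⁿ(K(M, m); N)` (Hatcher Prop. 4L.1; no Eilenberg–MacLane spaces in the tree). This file only
provides the language in which such operations, and facts about them (e.g. Atiyah–Hirzebruch 1962,
Thm. 6.1: `δ𝒫¹` annihilates complex analytic classes), are stated.

## Design notes

* Spaces range over a fixed universe `Type u` (the argument of `app`); `R M N : Type v` as in
  `…SingularCochains`. The universe `u` is not determined by the parameters `R M N m n`, so users
  write `CohomologyOperation.{u} R M N m n` when nothing else pins it (for complex points of
  varieties, `u = 0`).
* `app X` is a plain function (Hatcher's definition); additivity is the extra field `map_add'` of
  `AddCohomologyOperation`, whose `app X` is bundled as `addMonoidHom X : Hᵐ(X; M) →+ Hⁿ(X; N)`.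
  We do not ask `R`-linearity (Steenrod operations are only stated additive in Hatcher §4.L (2)).
* Mathlib has no cohomology operations (searched `CohomologyOperation`, `Steenrod`,
  `reducedPower`: nothing); Mathlib's `δ_naturality` for short exact sequences of complexes is what
  makes the Bockstein an operation.

## References

* A. Hatcher, *Algebraic Topology*, CUP 2002, §4.L p. 488 (cohomology operations, examples),
  p. 489 (properties of `Sqⁱ`, `Pⁱ`), §3.E p. 303 (Bockstein homomorphisms). [HatcherAT2002]
-/

noncomputable section

open CategoryTheory Limits

universe u v

namespace Literature.AlgebraicTopology.SingularHomology

variable (R : Type v) [CommRing R]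
variable (M N P : Type v) [AddCommGroup M] [Module R M] [AddCommGroup N] [Module R N]
  [AddCommGroup P] [Module R P]

/-- A **cohomology operation** of type `(m, M; n, N)` (over the ground ring `R` of the cochain
complexes): a family of maps `Θ_X : Hᵐ(X; M) → Hⁿ(X; N)`, one for every topological space
`X : Type u`, natural in continuous maps `f : X → Y`: `Θ_X (f^* α) = f^* (Θ_Y α)`. Not required to
be additive (Hatcher: `α ↦ αᵖ` is an operation but not a homomorphism for `R = ℤ`).
[cite: HatcherAT2002, §4.L p. 488] -/
structure CohomologyOperation (m n : ℕ) where
  /-- The component `Θ_X : Hᵐ(X; M) → Hⁿ(X; N)` at the space `X`. -/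
  app (X : Type u) [TopologicalSpace X] : singularCohomology R M X m → singularCohomology R N X n
  /-- Naturality: `Θ_X ∘ f^* = f^* ∘ Θ_Y` for every continuous `f : X → Y`. -/
  naturality' {X Y : Type u} [TopologicalSpace X] [TopologicalSpace Y] (f : C(X, Y))
    (x : singularCohomology R M Y m) :
    app X (singularCohomology.map R M f m x) = singularCohomology.map R N f n (app Y x)

/-- An **additive cohomology operation**: a cohomology operation all of whose components
`Θ_X : Hᵐ(X; M) → Hⁿ(X; N)` are homomorphisms of abelian groups (Hatcher, §4.L p. 488: the
Bockstein homomorphisms and the change-of-coefficient homomorphisms; property (2) of the Steenrod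
squares and powers, p. 489). [cite: HatcherAT2002, §4.L pp. 488–489] -/
structure AddCohomologyOperation (m n : ℕ) extends CohomologyOperation.{u} R M N m n where
  /-- Additivity of every component. -/
  map_add' (X : Type u) [TopologicalSpace X] (x y : singularCohomology R M X m) :
    app X (x + y) = app X x + app X y

variable {R M N P}
variable {X Y Z : Type u} [TopologicalSpace X] [TopologicalSpace Y] [TopologicalSpace Z]
variable {m n k : ℕ}

namespace CohomologyOperation

/-- Naturality of a cohomology operation, `Θ_X (f^* α) = f^* (Θ_Y α)` (Hatcher, §4.L p. 488).
[cite: HatcherAT2002, §4.L p. 488] -/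
theorem naturality (Θ : CohomologyOperation R M N m n) (f : C(X, Y))
    (x : singularCohomology R M Y m) :
    Θ.app X (singularCohomology.map R M f m x) = singularCohomology.map R N f n (Θ.app Y x) :=
  Θ.naturality' f x

/-- Two cohomology operations are equal when all their components agree (an operation IS the
family of its components; Hatcher, §4.L p. 488). [cite: HatcherAT2002, §4.L p. 488] -/
@[ext]
theorem ext {Θ Θ' : CohomologyOperation.{u} R M N m n}
    (h : ∀ (X : Type u) [TopologicalSpace X], Θ.app X = Θ'.app X) : Θ = Θ' := by
  cases Θ; cases Θ'
  congr
  funext X _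
  exact h X

variable (R M m) in
/-- The identity operation `Hᵐ(X; M) → Hᵐ(X; M)` (Hatcher, §4.L p. 489, property (6) `Sq⁰ = 1`).
[cite: HatcherAT2002, §4.L p. 489] -/
protected def id : CohomologyOperation.{u} R M M m m where
  app _ _ := id
  naturality' _ _ := rfl

/-- Unfolding: the identity operation acts as the identity. [folklore] -/
@[simp]
lemma id_app (x : singularCohomology R M X m) : (CohomologyOperation.id R M m).app X x = x := rfl

/-- Composition of cohomology operations, `(Θ₂ ∘ Θ₁)_X = Θ₂,X ∘ Θ₁,X` (operations compose to
operations; Hatcher, §4.L p. 488 and the Steenrod algebra, p. 496). [cite: HatcherAT2002, §4.L p. 488] -/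
def comp (Θ₂ : CohomologyOperation.{u} R N P n k) (Θ₁ : CohomologyOperation.{u} R M N m n) :
    CohomologyOperation.{u} R M P m k where
  app X _ x := Θ₂.app X (Θ₁.app X x)
  naturality' f x := by rw [Θ₁.naturality, Θ₂.naturality]

/-- Unfolding: a composite operation acts by composing the components. [folklore] -/
@[simp]
lemma comp_app (Θ₂ : CohomologyOperation.{u} R N P n k) (Θ₁ : CohomologyOperation.{u} R M N m n)
    (x : singularCohomology R M X m) : (Θ₂.comp Θ₁).app X x = Θ₂.app X (Θ₁.app X x) := rfl

variable (R m) in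
/-- Hatcher's first example: with coefficients in the ring `R`, the **cup square**
`Hᵐ(X; R) → H²ᵐ(X; R)`, `α ↦ α ⌣ α`, is a cohomology operation since `f^*(α ⌣ α) = f^*α ⌣ f^*α`
(naturality of the cup product, `cupProduct_map`); for `R = ℤ` it is not additive.
[cite: HatcherAT2002, §4.L p. 488] -/
def cupSquare : CohomologyOperation.{u} R R R m (m + m) where
  app _ _ x := cupProduct rfl x x
  naturality' f x := (cupProduct_map f rfl x x).symm

/-- Unfolding: the cup square sends `α` to `α ⌣ α`. [folklore] -/
@[simp]
lemma cupSquare_app (x : singularCohomology R R X m) :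
    (cupSquare R m).app X x = cupProduct rfl x x := rfl

end CohomologyOperation

namespace AddCohomologyOperation

/-- The component of an additive operation at `X` as a homomorphism of abelian groups
`Hᵐ(X; M) →+ Hⁿ(X; N)` (Hatcher, §4.L p. 488). [cite: HatcherAT2002, §4.L p. 488] -/
def addMonoidHom (Θ : AddCohomologyOperation.{u} R M N m n) (X : Type u) [TopologicalSpace X] :
    singularCohomology R M X m →+ singularCohomology R N X n :=
  AddMonoidHom.mk' (Θ.app X) (Θ.map_add' X)

/-- Unfolding: the bundled homomorphism is the component `Θ_X`. [folklore] -/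
@[simp]
lemma addMonoidHom_apply (Θ : AddCohomologyOperation.{u} R M N m n)
    (x : singularCohomology R M X m) : Θ.addMonoidHom X x = Θ.app X x := rfl

/-- Naturality of an additive operation (Hatcher, §4.L p. 488). [cite: HatcherAT2002, §4.L p. 488] -/
theorem naturality (Θ : AddCohomologyOperation.{u} R M N m n) (f : C(X, Y))
    (x : singularCohomology R M Y m) :
    Θ.app X (singularCohomology.map R M f m x) = singularCohomology.map R N f n (Θ.app Y x) :=
  Θ.naturality' f x

/-- Additivity (Hatcher, §4.L p. 489, property (2)). [cite: HatcherAT2002, §4.L p. 489] -/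
theorem map_add (Θ : AddCohomologyOperation.{u} R M N m n) (x y : singularCohomology R M X m) :
    Θ.app X (x + y) = Θ.app X x + Θ.app X y :=
  Θ.map_add' X x y

/-- An additive operation sends `0` to `0` (Hatcher, §4.L p. 489, from (2)). [cite: HatcherAT2002, §4.L p. 489] -/
@[simp]
theorem map_zero (Θ : AddCohomologyOperation.{u} R M N m n) :
    Θ.app X (0 : singularCohomology R M X m) = 0 :=
  (Θ.addMonoidHom X).map_zero

/-- An additive operation commutes with negation (Hatcher, §4.L p. 489, from (2)). [cite: HatcherAT2002, §4.L p. 489] -/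
theorem map_neg (Θ : AddCohomologyOperation.{u} R M N m n) (x : singularCohomology R M X m) :
    Θ.app X (-x) = -Θ.app X x :=
  (Θ.addMonoidHom X).map_neg x

/-- An additive operation commutes with subtraction (Hatcher, §4.L p. 489, from (2)). [cite: HatcherAT2002, §4.L p. 489] -/
theorem map_sub (Θ : AddCohomologyOperation.{u} R M N m n) (x y : singularCohomology R M X m) :
    Θ.app X (x - y) = Θ.app X x - Θ.app X y :=
  (Θ.addMonoidHom X).map_sub x y

/-- An additive operation commutes with integer multiples (Hatcher, §4.L p. 489, from (2)). [cite: HatcherAT2002, §4.L p. 489] -/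
theorem map_zsmul (Θ : AddCohomologyOperation.{u} R M N m n) (c : ℤ)
    (x : singularCohomology R M X m) : Θ.app X (c • x) = c • Θ.app X x :=
  _root_.map_zsmul (Θ.addMonoidHom X) c x

/-- Two additive operations are equal when all their components agree (Hatcher, §4.L p. 488).
[cite: HatcherAT2002, §4.L p. 488] -/
@[ext]
theorem ext {Θ Θ' : AddCohomologyOperation.{u} R M N m n}
    (h : ∀ (X : Type u) [TopologicalSpace X], Θ.app X = Θ'.app X) : Θ = Θ' := by
  cases Θ; cases Θ'
  congr
  exact CohomologyOperation.ext h

/-! ### Kernel of an additive operation -/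

/-- The kernel `{α ∈ Hᵐ(X; M) | Θ_X α = 0}` of an additive operation at `X`, a subgroup; e.g.
Atiyah–Hirzebruch's necessary condition for analyticity `δ𝒫¹ y = 0` is membership in such a
kernel (Hatcher, §4.L p. 488). [cite: HatcherAT2002, §4.L p. 488] -/
def ker (Θ : AddCohomologyOperation.{u} R M N m n) (X : Type u) [TopologicalSpace X] :
    AddSubgroup (singularCohomology R M X m) :=
  (Θ.addMonoidHom X).ker

/-- Membership in the kernel of an operation is the vanishing `Θ_X α = 0`. [folklore] -/
lemma mem_ker {Θ : AddCohomologyOperation.{u} R M N m n} {x : singularCohomology R M X m} :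
    x ∈ Θ.ker X ↔ Θ.app X x = 0 :=
  (Θ.addMonoidHom X).mem_ker

/-- Naturality makes kernels functorial: `f^*` maps `ker Θ_Y` into `ker Θ_X`
(Hatcher, §4.L p. 488). [cite: HatcherAT2002, §4.L p. 488] -/
theorem map_mem_ker (Θ : AddCohomologyOperation.{u} R M N m n) (f : C(X, Y))
    {x : singularCohomology R M Y m} (hx : x ∈ Θ.ker Y) :
    singularCohomology.map R M f m x ∈ Θ.ker X := by
  rw [mem_ker] at hx ⊢
  rw [Θ.naturality, hx, _root_.map_zero]

/-! ### Constructions -/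

/-- An additive operation from a family of morphisms `φ_X : Hᵐ(X; M) ⟶ Hⁿ(X; N)` of `R`-modules
satisfying the naturality square `f^* ≫ φ_X = φ_Y ≫ f^*` (the categorical form in which the
tree states naturality, e.g. `singularCohomology.map_mapCoeff`). [cite: HatcherAT2002, §4.L p. 488] -/
def ofHom (φ : ∀ (X : Type u) [TopologicalSpace X], singularCohomology R M X m ⟶ singularCohomology R N X n)
    (hφ : ∀ ⦃X Y : Type u⦄ [TopologicalSpace X] [TopologicalSpace Y] (f : C(X, Y)),
      singularCohomology.map R M f m ≫ φ X = φ Y ≫ singularCohomology.map R N f n) :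
    AddCohomologyOperation.{u} R M N m n where
  app X _ x := φ X x
  naturality' f x := by
    change (singularCohomology.map R M f m ≫ φ _) x = (φ _ ≫ singularCohomology.map R N f n) x
    rw [hφ]
  map_add' X _ x y := (φ X).hom.map_add x y

/-- Unfolding: the operation built by `ofHom` has components `φ_X`. [folklore] -/
@[simp]
lemma ofHom_app (φ : ∀ (X : Type u) [TopologicalSpace X], singularCohomology R M X m ⟶ singularCohomology R N X n)
    (hφ : ∀ ⦃X Y : Type u⦄ [TopologicalSpace X] [TopologicalSpace Y] (f : C(X, Y)),
      singularCohomology.map R M f m ≫ φ X = φ Y ≫ singularCohomology.map R N f n)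
    (x : singularCohomology R M X m) : (ofHom φ hφ).app X x = φ X x := rfl

/-- The zero operation `Hᵐ(X; M) → Hⁿ(X; N)`, `α ↦ 0` (the trivial element of the group of
additive operations; Hatcher, §4.L p. 488). [cite: HatcherAT2002, §4.L p. 488] -/
instance : Zero (AddCohomologyOperation.{u} R M N m n) :=
  ⟨{ app := fun _ _ _ ↦ 0
     naturality' := fun f _ ↦ (_root_.map_zero (singularCohomology.map R N f n).hom).symm
     map_add' := fun _ _ _ _ ↦ (add_zero _).symm }⟩

/-- Unfolding: the zero operation sends every class to `0`. [folklore] -/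
@[simp]
lemma zero_app (x : singularCohomology R M X m) :
    (0 : AddCohomologyOperation.{u} R M N m n).app X x = 0 := rfl

variable (R M m) in
/-- The identity as an additive operation (Hatcher, §4.L p. 489, property (6)). [cite: HatcherAT2002, §4.L p. 489] -/
protected def id : AddCohomologyOperation.{u} R M M m m where
  toCohomologyOperation := CohomologyOperation.id R M m
  map_add' _ _ _ _ := rfl

/-- Unfolding: the identity additive operation acts as the identity. [folklore] -/
@[simp]
lemma id_app (x : singularCohomology R M X m) : (AddCohomologyOperation.id R M m).app X x = x := rfl

/-- Composition of additive operations is additive (Hatcher, §4.L p. 496, the Steenrod algebra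
acts on `H^*(X; ℤ_p)`). [cite: HatcherAT2002, §4.L p. 496] -/
def comp (Θ₂ : AddCohomologyOperation.{u} R N P n k) (Θ₁ : AddCohomologyOperation.{u} R M N m n) :
    AddCohomologyOperation.{u} R M P m k where
  toCohomologyOperation := Θ₂.toCohomologyOperation.comp Θ₁.toCohomologyOperation
  map_add' X _ x y := by
    change Θ₂.app X (Θ₁.app X (x + y)) = Θ₂.app X (Θ₁.app X x) + Θ₂.app X (Θ₁.app X y)
    rw [Θ₁.map_add, Θ₂.map_add]

/-- Unfolding: a composite additive operation acts by composing the components. [folklore] -/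
@[simp]
lemma comp_app (Θ₂ : AddCohomologyOperation.{u} R N P n k)
    (Θ₁ : AddCohomologyOperation.{u} R M N m n) (x : singularCohomology R M X m) :
    (Θ₂.comp Θ₁).app X x = Θ₂.app X (Θ₁.app X x) := rfl

variable (m) in
/-- Hatcher's third example: a homomorphism of coefficient modules `g : M → N` induces the
**change-of-coefficients** operation `g_* : Hᵐ(X; M) → Hᵐ(X; N)`, natural by
`singularCohomology.map_mapCoeff`. [cite: HatcherAT2002, §4.L p. 488] -/
def mapCoeff (g : M →ₗ[R] N) : AddCohomologyOperation.{u} R M N m m :=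
  ofHom (fun X _ ↦ singularCohomology.mapCoeff X g m)
    (fun _ _ _ _ f ↦ singularCohomology.map_mapCoeff f g m)

/-- Unfolding: the change-of-coefficients operation is `singularCohomology.mapCoeff`. [folklore] -/
@[simp]
lemma mapCoeff_app (g : M →ₗ[R] N) (x : singularCohomology R M X m) :
    (mapCoeff m g).app X x = singularCohomology.mapCoeff X g m x := rfl

end AddCohomologyOperation

/-! ### The Bockstein homomorphism is a cohomology operation -/

section Bockstein

variable (f : M →ₗ[R] N) (g : N →ₗ[R] P) (hfg : Function.Exact f g) (hf : Function.Injective f)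
  (hg : Function.Surjective g)

/-- The morphism of short complexes of cochain complexes
`(C^•(Y; M) → C^•(Y; N) → C^•(Y; P)) ⟶ (C^•(X; M) → C^•(X; N) → C^•(X; P))` induced by a
continuous map `φ : X → Y` (pull-back in each coefficient module; the squares commute by
`singularCochainComplex.map_comp_mapCoeff`) (Hatcher 2002, §3.E p. 303 with §3.1 naturality).
[cite: HatcherAT2002, §3.E p. 303] -/
def singularCochainComplex.mapCoeffShortComplexMap (φ : C(X, Y)) (hfg' : g ∘ₗ f = 0) :
    singularCochainComplex.mapCoeffShortComplex Y f g hfg' ⟶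
      singularCochainComplex.mapCoeffShortComplex X f g hfg' where
  τ₁ := singularCochainComplex.map R M φ
  τ₂ := singularCochainComplex.map R N φ
  τ₃ := singularCochainComplex.map R P φ
  comm₁₂ := singularCochainComplex.map_comp_mapCoeff φ f
  comm₂₃ := singularCochainComplex.map_comp_mapCoeff φ g

/-- **Naturality of the Bockstein in the space**: for a continuous `φ : X → Y`,
`β_Y ≫ φ^* = φ^* ≫ β_X : Hⁿ(Y; P) → Hⁿ⁺¹(X; M)` — the connecting homomorphism of the coefficient
sequence is natural for maps of spaces (Hatcher 2002, §3.E p. 303, "Bockstein homomorphisms …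
are examples of cohomology operations", §4.L p. 488). Proved from Mathlib's
`HomologicalComplex.HomologySequence.δ_naturality`. [cite: HatcherAT2002, §4.L p. 488] -/
theorem cohomologyBockstein_natural (φ : C(X, Y)) (n : ℕ) :
    cohomologyBockstein Y f g hfg hf hg n ≫ singularCohomology.map R M φ (n + 1) =
      singularCohomology.map R P φ n ≫ cohomologyBockstein X f g hfg hf hg n :=
  HomologicalComplex.HomologySequence.δ_naturality
    (singularCochainComplex.mapCoeffShortComplexMap f g φ hfg.linearMap_comp_eq_zero)
    (singularCochainComplex.shortExact_mapCoeffShortComplex Y f g hfg hf hg)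
    (singularCochainComplex.shortExact_mapCoeffShortComplex X f g hfg hf hg) n (n + 1) rfl

/-- Hatcher's second example: the **Bockstein** `β : Hⁿ(X; P) → Hⁿ⁺¹(X; M)` of a short exact
sequence of coefficient modules `0 → M → N → P → 0` is an additive cohomology operation
(Hatcher 2002, §3.E p. 303 and §4.L p. 488). [cite: HatcherAT2002, §4.L p. 488] -/
def AddCohomologyOperation.bockstein (n : ℕ) : AddCohomologyOperation.{u} R P M n (n + 1) :=
  AddCohomologyOperation.ofHom (fun X _ ↦ cohomologyBockstein X f g hfg hf hg n)
    (fun _ _ _ _ φ ↦ (cohomologyBockstein_natural f g hfg hf hg φ n).symm)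

/-- Unfolding: the Bockstein operation has components `cohomologyBockstein X f g`. [folklore] -/
@[simp]
lemma AddCohomologyOperation.bockstein_app (n : ℕ) (x : singularCohomology R P X n) :
    (AddCohomologyOperation.bockstein f g hfg hf hg n).app X x =
      cohomologyBockstein X f g hfg hf hg n x := rfl

end Bockstein

section Integral

variable (m₀ : ℕ)

/-- **Reduction modulo `m₀`**, `ρ : Hⁿ(X; ℤ) → Hⁿ(X; ℤ/m₀)`, as an additive cohomology operation
(change of coefficients along `ℤ → ℤ/m₀`; Hatcher 2002, §3.E p. 303 and §4.L p. 488).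
[cite: HatcherAT2002, §4.L p. 488] -/
def AddCohomologyOperation.reduceMod (n : ℕ) : AddCohomologyOperation.{u} ℤ ℤ (ZMod m₀) n n :=
  AddCohomologyOperation.mapCoeff n (intCastZModLinearMap m₀)

/-- Unfolding: the reduction operation has components the tree's `reduceMod X m₀ n`. [folklore] -/
@[simp]
lemma AddCohomologyOperation.reduceMod_app (n : ℕ) (x : singularCohomology ℤ ℤ X n) :
    (AddCohomologyOperation.reduceMod m₀ n).app X x =
      Literature.AlgebraicTopology.SingularHomology.reduceMod X m₀ n x := rfl

variable [NeZero m₀]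

/-- The **integral Bockstein** `β̃ : Hⁿ(X; ℤ/m₀) → Hⁿ⁺¹(X; ℤ)` of `0 → ℤ →ᵐ⁰ ℤ → ℤ/m₀ → 0` as an
additive cohomology operation (Hatcher 2002, §3.E p. 303, `β̃`; §4.L p. 488).
[cite: HatcherAT2002, §4.L p. 488] -/
def AddCohomologyOperation.integralBockstein (n : ℕ) :
    AddCohomologyOperation.{u} ℤ (ZMod m₀) ℤ n (n + 1) :=
  AddCohomologyOperation.bockstein (LinearMap.lsmul ℤ ℤ m₀) (intCastZModLinearMap m₀)
    (exact_lsmul_intCast m₀) (injective_lsmul m₀) (surjective_intCast m₀) n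

/-- Unfolding: the integral Bockstein operation has components the tree's `integralBockstein X m₀ n`. [folklore] -/
@[simp]
lemma AddCohomologyOperation.integralBockstein_app (n : ℕ) (x : singularCohomology ℤ (ZMod m₀) X n) :
    (AddCohomologyOperation.integralBockstein m₀ n).app X x =
      Literature.AlgebraicTopology.SingularHomology.integralBockstein X m₀ n x := rfl

/-- `β̃ ∘ ρ = 0`: the integral Bockstein kills reductions of integral classes, as an identity of
operations at each space (Hatcher 2002, §3.E p. 303). [cite: HatcherAT2002, §3.E p. 303] -/
theorem AddCohomologyOperation.integralBockstein_app_reduceMod_app (n : ℕ)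
    (x : singularCohomology ℤ ℤ X n) :
    (AddCohomologyOperation.integralBockstein m₀ n).app X
      ((AddCohomologyOperation.reduceMod m₀ n).app X x) = 0 := by
  change (Literature.AlgebraicTopology.SingularHomology.reduceMod X m₀ n ≫
    Literature.AlgebraicTopology.SingularHomology.integralBockstein X m₀ n) x = 0
  rw [reduceMod_comp_integralBockstein]
  rfl

end Integral

end Literature.AlgebraicTopology.SingularHomology
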